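/-
Origin: expansion seat `planner-pub-hodgecm-pv15-g2-0`, handover #6 v2 2026-08-18T07:01:05Z (`HOME/pub-hodgecm-pv15-g2/lean/Pv15g2/KernelModelAnnihilation.lean`, md5 930de45e, 229 lines);
landed by the gen-7 packager in gate run 25 as `HodgeCM/Automorphic/KernelModelAnnihilation.lean` (import ^import Pv15g2\.→import HodgeCM.Automorphic. ×1; import ^import Pv[0-9]+g[0-9]+\.→import HodgeCM.PerL34. ×1).
-/
/-
Origin: HOME/pub-hodgecm-pv15-g2/lean/Pv15g2/KernelModelAnnihilation.lean — session planner-pub-hodgecm-pv15-g2-0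
(unit pub-hodgecm-pv15-g2, DAG-NODE PROVER #15 gen 2; lineage N23a × pv06-g3's N23c).
Intended final place (packager's call): `HodgeCM/Automorphic/KernelModelAnnihilation.lean`.
NEW, ADDITIVE LEAF; WIP imports ↦ landed names: `Pv15g2.KernelModelCarrier` ↦ `HodgeCM.Automorphic.KernelModelCarrier`
(my HANDOVER #5), `Pv06g3.AnnihilationModel` ↦ `HodgeCM.PerL34.AnnihilationModel` (pv06-g3 HANDOVER #8 v2,
3b8cd75fe5bc; it imports their #5 v2 `AnnihilationRep` 92caa9f4bc97, which imports #4 `WeightProjection`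
1f93046b6aa5).
Lands AFTER all of these.  KIND: KERNEL glue + END STATE — nothing cited, nothing posited.
-/
import Summits.HodgeConjecture.HodgeCM.Automorphic.KernelModelCarrier
import Summits.HodgeConjecture.HodgeCM.PerL34.AnnihilationModel_2

/-!
# AX8 in the kernel model from pv06-g3's annihilation datum; the end state over models and data

pv06-g3's `RepAnnihilationDatum C D` (`AnnihilationRep`) proves `AX8_annihilation` for a representation-theoretic
torus carrier `D` over a core `C` from labelled Step-2 data, GIVEN `hC : C.Analytic` (unitarity + discrete
decomposition + `hatτ_complete`) and `hT` (= AX12_E_transl); their `QuotientTorusDatum ν C D` (`AnnihilationModel`) is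
the REDUCED datum over the cocompact model `H = L²(G ⧸ Γ, ν)`, GIVEN moreover `hR : C.R = ρHom ν` and [SETUP D7]
smoothing data `S : SmoothingData ν C.R` (which they CONSTRUCT for Haar measure on a first-countable `G`,
`smoothingData_haar`).

In this seat's kernel model all four provisos are THEOREMS / CONSTRUCTIONS: `hC` is
`RegCoreCarrier.analytic_of_cocompact` (pv06-g3's `discreteDecomp_haar` underneath) with `hatτ_complete`, `hT` is
`RegTorusCarrier.AX12_E_transl_holds` (N23a), `hR` is `RegularRep.koopman_eq_ρHom`, and `S` is their
`smoothingData_haar` in the cocompact Haar model.  Hence (§1) `KernelTorusCarrier.analyticK_of_repDatum /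
analyticK_of_quotientDatum`: the kernel model's last torus-side hypothesis `AnalyticK` (= AX8) from a datum; (§2) over
`Universe.KernelModelThetaData` (both quotients compact Haar quotient MODELS, `hatτ_complete` prl1-g3's theorem):
`analyticKM_of_quotientData : D.Structural → (2 reduced torus datums per context) → D.AnalyticKM`; (§3) the END STATE
`Assembly.COR_CM_endState_ofKernelModelData`, whose hypotheses of PerL §3's analytic content are exactly: the three
STRUCTURAL laws of the theta kernels (`ω(1) = id`, continuity of `Φ ↦ θ_Φ`, Weil-equivariance l. 414) and, per
context and torus side, pv06-g3's reduced `QuotientTorusDatum` (torus, weight, characters and toric periods of `[T]`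
with the [ELEMENTARY] covariance, the finite-adelic factor, and the labelled inputs `unfold` [AX12(ii)],
`fourier`/`dense` [PRINT]) and the first countability of `U(W)(𝔸)`.  AX5b, AX9, AX12 (all forms), (U), AX8,
[SETUP D7], `R_unitary`, `discreteDecomp`, `hatτ_complete` ×(both sides) are theorems of the models.
-/

set_option autoImplicit false

noncomputable section

open MeasureTheory Set Filter Function Topology
open scoped InnerProductSpace

attribute [-instance] Quotient.instMeasurableSpace

namespace HodgeCM

open HodgeCM.PerL34 HodgeCM.PerL34.QuotientSmoothing HodgeCM.PerL34.Annihilation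

/-! ## 1. Carrier level: `AnalyticK` (AX8) from an annihilation datum -/

namespace KernelTorusCarrier

variable {G : Type} [Group G] [TopologicalSpace G] [IsTopologicalGroup G] [T2Space G] [LocallyCompactSpace G]
  [MeasurableSpace G] [BorelSpace G]
variable {Γ : Subgroup G} [DiscreteTopology Γ] [IsClosed (Γ : Set G)] [MeasurableSpace (G ⧸ Γ)] [BorelSpace (G ⧸ Γ)]
  [CompactSpace (G ⧸ Γ)]
variable {μQ : Measure (G ⧸ Γ)} [SMulInvariantMeasure G (G ⧸ Γ) μQ] [IsFiniteMeasure μQ]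
variable {XU : Type} [TopologicalSpace XU] [CompactSpace XU]
variable {HG : Type} [NormedAddCommGroup HG] [InnerProductSpace ℂ HG] [CompleteSpace HG]
variable {SK SigIdxG : Type} [TopologicalSpace SK]
variable {K : KernelCoreCarrier G Γ μQ XU HG SK SigIdxG}
variable {T : Type} [Group T] [TopologicalSpace T] [MeasurableSpace T] [OpensMeasurableSpace T]
variable (D : KernelTorusCarrier K T) [IsFiniteMeasureOnCompacts D.ν]

/-- **AX8 in the kernel model from a labelled annihilation datum** (pv06-g3's `RepAnnihilationDatum`) over the
kernel model's gen-3 core and torus carrier, in the cocompact Haar model with `hatτ_complete`: the datum's provisos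
`hC` (the core's analytic record) and `hT` (AX12_E_transl) are theorems here. -/
theorem analyticK_of_repDatum {μ : Measure G} (hM : RegularRep.IsCocompactHaarModel Γ μQ μ)
    (hτ : (⨆ j, K.hatτ j).topologicalClosure = ⊤)
    (A : RepAnnihilationDatum K.toRegCoreCarrier.toRepCoreCarrier D.toRegTorusCarrier.toRepTorusCarrier) :
    D.AnalyticK where
  AX8_annihilation := A.AX8_annihilation
    (K.toRegCoreCarrier.toRepCoreCarrier_analytic (K.toRegCoreCarrier.analytic_of_cocompact hM hτ))
    (fun h x f => D.toRegTorusCarrier.AX12_E_transl_holds h x f)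

omit [T2Space G] [LocallyCompactSpace G] [DiscreteTopology Γ] [IsClosed (Γ : Set G)] in
/-- `R = ρHom μQ` for the kernel model's gen-3 core (`RegularRep.koopman_eq_ρHom`). -/
theorem toRepCoreCarrier_R_eq_ρHom : K.toRegCoreCarrier.toRepCoreCarrier.R = ρHom μQ := by
  rw [RegCoreCarrier.toRepCoreCarrier_R]
  exact RegularRep.koopman_eq_ρHom μQ

omit [T2Space G] in
/-- **[SETUP D7] in the kernel model**: pv06-g3's smoothing data for the kernel model's gen-3 core, CONSTRUCTED in
the cocompact Haar model on a first-countable `G` (their `smoothingData_haar`, transported along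
`μQ = π_*(μ|𝓕)` and `R = koopman μQ = ρHom μQ`). -/
theorem nonempty_smoothingData [FirstCountableTopology G] {μ : Measure G}
    (hM : RegularRep.IsCocompactHaarModel Γ μQ μ) :
    Nonempty (SmoothingData μQ K.toRegCoreCarrier.toRepCoreCarrier.R) := by
  obtain ⟨𝓕, h𝓕, hν⟩ := hM.exists_fundamentalDomain
  haveI := hM.isHaar
  haveI := hM.regular
  haveI := hM.rightInvariant
  haveI := hM.countable
  rw [toRepCoreCarrier_R_eq_ρHom]
  subst hν
  exact ⟨smoothingData_haar ‹IsClosed (Γ : Set G)› μ h𝓕⟩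

/-- **AX8 in the kernel model from pv06-g3's REDUCED model datum** (`QuotientTorusDatum`): the provisos
`hR : R = ρHom μQ` and `S : SmoothingData` are a theorem / a construction too. -/
theorem analyticK_of_quotientDatum [T2Space (G ⧸ Γ)] [μQ.InnerRegularCompactLTTop] [FirstCountableTopology G]
    {μ : Measure G} (hM : RegularRep.IsCocompactHaarModel Γ μQ μ) (hτ : (⨆ j, K.hatτ j).topologicalClosure = ⊤)
    (A : QuotientTorusDatum μQ K.toRegCoreCarrier.toRepCoreCarrier D.toRegTorusCarrier.toRepTorusCarrier) :
    D.AnalyticK := by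
  obtain ⟨S⟩ := nonempty_smoothingData (K := K) hM
  exact ⟨A.AX8_annihilation S (toRepCoreCarrier_R_eq_ρHom (K := K))
    (K.toRegCoreCarrier.toRepCoreCarrier_analytic (K.toRegCoreCarrier.analytic_of_cocompact hM hτ))
    (fun h x f => D.toRegTorusCarrier.AX12_E_transl_holds h x f)⟩

end KernelTorusCarrier

/-! ## 2. Model level -/

namespace QuotientModel

variable (Q : QuotientModel)

/-- `ν` is inner regular w.r.t. compacts (landed `innerRegularCompactLTTop_map_restrict`; pv06-g3's queued
`ModelAnnihilation` registers the same instance as `innerRegularCompactLTTop_ν`). -/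
instance innerRegular_ν : Q.ν.InnerRegularCompactLTTop := innerRegularCompactLTTop_map_restrict (Γ := Q.Γ) Q.μ Q.𝓕

/-- `G ⧸ Γ` is Hausdorff (`Γ` closed; pv06-g3's `t2Space_quotient` is the same instance). -/
instance t2Space_Q : T2Space (Q.G ⧸ Q.Γ) := inferInstance

end QuotientModel

namespace Universe

namespace KernelModelThetaData

open HodgeCM.Prior.Perl34File HodgeCM.Prior.Perl34File.Perl34

variable {U : Universe} (D : U.KernelModelThetaData)

/-- **`AnalyticKM` over models from the three structural laws and two reduced torus datums per context**, for
first-countable `U(W)(𝔸)` (`hatτ_complete` of the `G_U` model: prl1-g3's `QuotientModel.iSup_isotypic_R`; the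
cocompact Haar model: `QuotientModel.isCocompactHaarModel`; [SETUP D7]: pv06-g3's `smoothingData_haar`). -/
theorem analyticKM_of_quotientData (hS : D.Structural)
    (hfc : ∀ {L : CMField} {ι₁ : L →+* ℂ} (V : HermSpace3 L ι₁) (c : SeesawCtx L),
      FirstCountableTopology (D.quot V c).G)
    (A12 : ∀ {L : CMField} {ι₁ : L →+* ℂ} (V : HermSpace3 L ι₁) (c : SeesawCtx L),
      QuotientTorusDatum (D.quot V c).ν (D.kcore V c).toRegCoreCarrier.toRepCoreCarrier
        (D.kt12 V c).toRegTorusCarrier.toRepTorusCarrier)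
    (A34 : ∀ {L : CMField} {ι₁ : L →+* ℂ} (V : HermSpace3 L ι₁) (c : SeesawCtx L),
      QuotientTorusDatum (D.quot V c).ν (D.kcore V c).toRegCoreCarrier.toRepCoreCarrier
        (D.kt34 V c).toRegTorusCarrier.toRepTorusCarrier) :
    D.AnalyticKM :=
  AnalyticKM.of_structural hS
    (fun {L} {ι₁} V c => by
      haveI := hfc V c
      exact (D.kt12 V c).analyticK_of_quotientDatum (D.quot V c).isCocompactHaarModel
        (KernelModel.core_hatτ_complete (D.quotU L ι₁ V) (D.quot V c) (D.SK V c) (D.omg V c) (D.θ V c)) (A12 V c))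
    (fun {L} {ι₁} V c => by
      haveI := hfc V c
      exact (D.kt34 V c).analyticK_of_quotientDatum (D.quot V c).isCocompactHaarModel
        (KernelModel.core_hatτ_complete (D.quotU L ι₁ V) (D.quot V c) (D.SK V c) (D.omg V c) (D.θ V c)) (A34 V c))

/-- The same from pv06-g3's full (unreduced) annihilation datums. -/
theorem analyticKM_of_repData (hS : D.Structural)
    (A12 : ∀ {L : CMField} {ι₁ : L →+* ℂ} (V : HermSpace3 L ι₁) (c : SeesawCtx L),
      RepAnnihilationDatum (D.kcore V c).toRegCoreCarrier.toRepCoreCarrier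
        (D.kt12 V c).toRegTorusCarrier.toRepTorusCarrier)
    (A34 : ∀ {L : CMField} {ι₁ : L →+* ℂ} (V : HermSpace3 L ι₁) (c : SeesawCtx L),
      RepAnnihilationDatum (D.kcore V c).toRegCoreCarrier.toRepCoreCarrier
        (D.kt34 V c).toRegTorusCarrier.toRepTorusCarrier) :
    D.AnalyticKM :=
  AnalyticKM.of_structural hS
    (fun {L} {ι₁} V c => (D.kt12 V c).analyticK_of_repDatum (D.quot V c).isCocompactHaarModel
      (KernelModel.core_hatτ_complete (D.quotU L ι₁ V) (D.quot V c) (D.SK V c) (D.omg V c) (D.θ V c)) (A12 V c))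
    (fun {L} {ι₁} V c => (D.kt34 V c).analyticK_of_repDatum (D.quot V c).isCocompactHaarModel
      (KernelModel.core_hatτ_complete (D.quotU L ι₁ V) (D.quot V c) (D.SK V c) (D.omg V c) (D.θ V c)) (A34 V c))

end KernelModelThetaData

end Universe

/-! ## 3. END STATE over models and data -/

namespace Assembly

open HodgeCM.Prior.Perl34File HodgeCM.Prior.Perl34File.Perl34
open HodgeCM.Universe (KernelModelThetaData ThetaModel)

variable (U : Universe)

/-- **COR-CM, END STATE over MODELS and DATA.**  Hypotheses: the model facts `M`, `h29`, `h30`; the QW8 facts;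
Hodge–Riemann; the kernel-model theta DATA `D` over two compact Haar quotient models per context; the three
STRUCTURAL laws `hS` of the theta kernels; first countability of `U(W)(𝔸)`; per context and torus side pv06-g3's
REDUCED annihilation datum (`QuotientTorusDatum`: Step-2 data with its labelled [AX12(ii)] / [PRINT] fields); the ten
theta `Inputs`.
No named analytic proposition of PerL §3's carrier (AX1b, AX5b, AX8, AX9, AX12, (U)) is a hypothesis. -/
theorem COR_CM_endState_ofKernelModelData (M : U.ModelAxioms) (h29 : U.Fact_weightSpan)
    (h30 : U.Fact_weightHodge) (hE : U.Qw8ExtProd) (hD : U.Qw8DualPushPull) (hMi : U.Qw8Milne)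
    (D : U.KernelModelThetaData) (hS : D.Structural)
    (hfc : ∀ {L : CMField} {ι₁ : L →+* ℂ} (V : HermSpace3 L ι₁) (c : SeesawCtx L),
      FirstCountableTopology (D.quot V c).G)
    (A12 : ∀ {L : CMField} {ι₁ : L →+* ℂ} (V : HermSpace3 L ι₁) (c : SeesawCtx L),
      QuotientTorusDatum (D.quot V c).ν (D.kcore V c).toRegCoreCarrier.toRepCoreCarrier
        (D.kt12 V c).toRegTorusCarrier.toRepTorusCarrier)
    (A34 : ∀ {L : CMField} {ι₁ : L →+* ℂ} (V : HermSpace3 L ι₁) (c : SeesawCtx L),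
      QuotientTorusDatum (D.quot V c).ν (D.kcore V c).toRegCoreCarrier.toRepCoreCarrier
        (D.kt34 V c).toRegTorusCarrier.toRepTorusCarrier)
    (A : (ThetaModel.ofRegCarrier D.toKernelThetaCarrier.toRegThetaCarrier
      (D.analyticKM_of_quotientData hS hfc A12 A34).toAnalytic).Inputs)
    (hHR : U.Fact_hodgeRiemann20) : U.HC_CM :=
  COR_CM_endState_ofKernelModel U M h29 h30 hE hD hMi D (D.analyticKM_of_quotientData hS hfc A12 A34) A hHR

/-- **PerL over models and data** (same hypotheses short of QW8 / the weight facts). -/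
theorem perL_ofKernelModelData (M : U.ModelAxioms) (D : U.KernelModelThetaData) (hS : D.Structural)
    (hfc : ∀ {L : CMField} {ι₁ : L →+* ℂ} (V : HermSpace3 L ι₁) (c : SeesawCtx L),
      FirstCountableTopology (D.quot V c).G)
    (A12 : ∀ {L : CMField} {ι₁ : L →+* ℂ} (V : HermSpace3 L ι₁) (c : SeesawCtx L),
      QuotientTorusDatum (D.quot V c).ν (D.kcore V c).toRegCoreCarrier.toRepCoreCarrier
        (D.kt12 V c).toRegTorusCarrier.toRepTorusCarrier)
    (A34 : ∀ {L : CMField} {ι₁ : L →+* ℂ} (V : HermSpace3 L ι₁) (c : SeesawCtx L),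
      QuotientTorusDatum (D.quot V c).ν (D.kcore V c).toRegCoreCarrier.toRepCoreCarrier
        (D.kt34 V c).toRegTorusCarrier.toRepTorusCarrier)
    (A : (ThetaModel.ofRegCarrier D.toKernelThetaCarrier.toRegThetaCarrier
      (D.analyticKM_of_quotientData hS hfc A12 A34).toAnalytic).Inputs)
    (hHR : U.Fact_hodgeRiemann20) : U.PerL :=
  perL_ofKernelModel U M D (D.analyticKM_of_quotientData hS hfc A12 A34) A hHR

end Assembly

end HodgeCM

end
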